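import Summits.HodgeConjecture.CorCM.GaloisSkewSection
import Summits.HodgeConjecture.CorCM.GaloisSectionCountBad
import HarnessLib

/-!
# Skew CM sets from a non-central involution, counted BY INVOLUTION CLASSES — the group core

COR-CM (cell `pub-hodgecm2`), binder seat b04 (gen 36), count-neutral own lane «Galois-CM-type classification».  KERNEL ONLY,
Mathlib only: theorems; no definition, no named fact, no `sorry`.  Sharpening of gen 32's `CorCM/GaloisSkewSection` («a non-central
involution ⟹ a skew CM set for `|G| ≥ 64`», `≥ 52` by gen 33) for SMALL orders — the order-`32` base of the `2`-power
classification (A7-JUNCTION gen-36 addendum) and concrete table models, where the count below is `decide`d.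

SETTING (gen 32).  `G` finite, `c ∈ Z(G)` an involution, `u` a NON-central involution, `H = {1, u, c, cu}`, `P = G/H`
(`|P| = n = |G|/4`), sections `T_ε` (`ε : P → Bool`): CM sets for `c` with `T_ε u = T_ε`; a left stabiliser `v` of `T_ε` forces
the twisted system `ε(v·q) = ε(q) ⊻ α_v(q)`, and a fixed point `q` of `v` has `rep(q)⁻¹ v rep(q) ∈ {u, c, cu}`, with trivial
twist iff it is `u`.  NEW COUNTING.  (1) When every `v ≠ 1` has a power which is an involution (e.g. in a `2`-group) it suffices to
violate the systems of the INVOLUTIONS `v ≠ c` (`c T_ε = G ∖ T_ε` never stabilises).  (2) A `v` with a badly-twisted fixed point —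
every conjugate of `cu` — stabilises NO section (`CorCM/GaloisSectionCountBad`).  (3) For `v ∈ u^G` (`k = |u^G|`) the
trivially-twisted fixed points number `≤ |C_G(u)|/4`, for every other involution `0`.  Hence
**`exists_skew_of_noncentral_involution_classes`**: a skew section exists as soon as

  `I'·2^(n/2) + [u ≁ cu]·k·2^((n + |C_G(u)|/4)/2) < 2^n`,  `I' = #{involutions v ∉ {1, c} ∪ u^G ∪ (cu)^G}`

— a decidable condition; at `|G| = 32` (`n = 8`): `I' < 16` if `u ~ cu`.  By the seat's census it holds for some non-central
involution of every `(G, c)` of order `32` that has one, except `D₄×C₂²`, `(C₄∘D₄)×C₂` (`c` not the square), `D₁₆×C₂` (`c ∉ D₁₆`),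
`((C₄×C₂)⋊C₂)×C₂` (`c` not the commutator) — all BAD through a CM quotient of order `16` — and `2^{1+4}_+` (equality `256 = 2^8`).
Galois dress: `CorCM/GaloisNonCentralInvolutionClasses`.

## References

* [Shimura1998] G. Shimura, *Abelian Varieties with Complex Multiplication and Modular Functions*, §8.2 Prop. 26, §32.10.
* [Kubota1965] T. Kubota, *On the field extension by complex multiplication*, Trans. AMS 118 (1965), §2 (context).
-/

namespace Summit.HodgeConjecture.CorCM.GaloisModels.SkewSection

open Finset

variable {G : Type*} [Group G] [Fintype G] [DecidableEq G]

/-- **A NON-CENTRAL INVOLUTION YIELDS A SKEW CM SET — count by involution classes.**  `G` finite in which every `v ≠ 1` has a power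
which is an involution (e.g. a `2`-group), `c` a central involution, `u` a non-central involution, `k = |u^G|`, `C = |C_G(u)|`,
`n = |G|/4`, `I'` = the number of involutions outside `{1, c} ∪ u^G ∪ (cu)^G`.  If
`I'·2^(n/2) + [u ≁ cu]·k·2^((n + C/4)/2) < 2^n` then there is `T ⊆ G` with `x ∈ T ↔ cx ∉ T`, trivial left stabiliser and `T u = T`.
[cite: Shimura1998, §8.2 Prop. 26 and §32.10] -/
theorem exists_skew_of_noncentral_involution_classes (c u : G) (hcc : c * c = 1) (hc1 : c ≠ 1)
    (hcen : ∀ g : G, c * g = g * c) (huu : u * u = 1) (hu1 : u ≠ 1) (hnc : ∃ g : G, g * u ≠ u * g)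
    (h2 : ∀ v : G, v ≠ 1 → ∃ m : ℕ, v ^ m ≠ 1 ∧ v ^ m * v ^ m = 1)
    (hcount : (Finset.univ.filter fun v : G => v * v = 1 ∧ v ≠ 1 ∧ v ≠ c ∧ (∀ g : G, g * u * g⁻¹ ≠ v) ∧
        (∀ g : G, g * u * g⁻¹ ≠ c * v)).card * 2 ^ (Fintype.card G / 4 / 2) +
      (if ∃ g : G, g * u * g⁻¹ = c * u then 0 else
        (Finset.univ.filter fun v : G => ∃ g : G, g * u * g⁻¹ = v).card *
          2 ^ ((Fintype.card G / 4 + (Finset.univ.filter fun g : G => g * u = u * g).card / 4) / 2)) <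
      2 ^ (Fintype.card G / 4)) :
    ∃ T : Finset G, (∀ x, x ∈ T ↔ c * x ∉ T) ∧ (∀ v : G, v ≠ 1 → ∃ w, ¬ (w ∈ T ↔ v * w ∈ T)) ∧
      (∀ x, x * u ∈ T ↔ x ∈ T) := by
  classical
  -- relations
  have huc : u ≠ c := fun h => by obtain ⟨g, hg⟩ := hnc; exact hg (by rw [h, hcen])
  have hcu : c * u = u * c := hcen u
  have hcu1 : c * u ≠ 1 := fun h => huc (by
    have := congrArg (c * ·) h; simp only [← mul_assoc, hcc, one_mul, mul_one] at this; exact this)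
  have hcuc : c * u ≠ c := fun h => hu1 (mul_left_cancel (h.trans (mul_one c).symm))
  have hcuu : c * u ≠ u := fun h => hc1 (mul_right_cancel (h.trans (one_mul u).symm))
  have r1 : u * (c * u) = c := by rw [← mul_assoc, ← hcu, mul_assoc, huu, mul_one]
  have r2 : c * (c * u) = u := by rw [← mul_assoc, hcc, one_mul]
  have r3 : c * u * u = c := by rw [mul_assoc, huu, mul_one]
  have r4 : c * u * c = u := by rw [mul_assoc, ← hcu, ← mul_assoc, hcc, one_mul]
  have r5 : c * u * (c * u) = 1 := by rw [← mul_assoc, r4, huu]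
  have r6 : u * c = c * u := hcu.symm
  -- the four-group and the coset space
  set H : Subgroup G := Subgroup.closure ({u, c} : Set G) with hHdef
  have hH : ∀ x, x ∈ H ↔ (x = 1 ∨ x = u ∨ x = c ∨ x = c * u) := mem_closure_pair_iff hcc huu hcu
  have hHcomm : ∀ w, w ∈ H → w * u = u * w := by
    intro w hw; rcases (hH w).1 hw with rfl | rfl | rfl | rfl
    · rw [one_mul, mul_one]
    · rfl
    · exact hcu
    · rw [r3, r1]
  haveI : Fintype (G ⧸ H) := Fintype.ofFinite _
  set rep : G ⧸ H → G := Quotient.out with hrepdef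
  have hrep : ∀ q : G ⧸ H, ((rep q : G) : G ⧸ H) = q := fun q => Quotient.out_eq q
  have hcoe : ∀ y w : G, w ∈ H → ((y * w : G) : G ⧸ H) = (y : G ⧸ H) := fun y w hw =>
    (QuotientGroup.eq.2 (by rw [inv_mul_cancel_left]; exact hw)).symm
  have hrepH : ∀ x : G, (rep (x : G ⧸ H))⁻¹ * x ∈ H := fun x => QuotientGroup.eq.1 (hrep _)
  -- the character `χ` of `H` with kernel `{1, u}` and the «upper» predicate
  set χ : G → Bool := fun w => decide (w = c ∨ w = c * u) with hχ
  have hχmul : ∀ h w, h ∈ H → w ∈ H → χ (h * w) = xor (χ h) (χ w) := by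
    intro h w hh hw
    rcases (hH h).1 hh with rfl | rfl | rfl | rfl <;> rcases (hH w).1 hw with rfl | rfl | rfl | rfl <;>
      simp [hχ, huu, hcc, r1, r2, r3, r4, r5, r6, hc1.symm, hcu1.symm, huc, hcuc, hcuc.symm, hcuu.symm]
  set up : G → Bool := fun x => χ ((rep (x : G ⧸ H))⁻¹ * x) with hup
  have hupmul : ∀ y w : G, w ∈ H → up (y * w) = xor (up y) (χ w) := by
    intro y w hw
    simp only [hup]
    rw [hcoe y w hw, ← mul_assoc]
    exact hχmul _ _ (hrepH y) hw
  have huprep : ∀ q : G ⧸ H, up (rep q) = false := by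
    intro q
    have e : rep ((rep q : G) : G ⧸ H) = rep q := by rw [hrep]
    simp only [hup, e, inv_mul_cancel, hχ, hc1.symm, hcu1.symm, or_self, decide_false]
  have huH : u ∈ H := (hH u).2 (Or.inr (Or.inl rfl))
  have hcH : c ∈ H := (hH c).2 (Or.inr (Or.inr (Or.inl rfl)))
  have hcuH : c * u ∈ H := (hH (c * u)).2 (Or.inr (Or.inr (Or.inr rfl)))
  have hχu : χ u = false := by simp [hχ, huc, hcuu.symm]
  have hχc : χ c = true := by simp [hχ]
  have hχcu : χ (c * u) = true := by simp [hχ]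
  -- the section sets
  have hT : ∀ (ε : G ⧸ H → Bool) (x : G), x ∈ (Finset.univ.filter fun y : G => up y = ε (y : G ⧸ H)) ↔ up x = ε x :=
    fun ε x => by rw [Finset.mem_filter, and_iff_right (Finset.mem_univ x)]
  -- (a) right `u`-invariance, (b) CM for `c`
  have hTu : ∀ (ε : G ⧸ H → Bool) (x : G), x * u ∈ (Finset.univ.filter fun y : G => up y = ε (y : G ⧸ H)) ↔
      x ∈ (Finset.univ.filter fun y : G => up y = ε (y : G ⧸ H)) := by
    intro ε x; rw [hT, hT, hupmul x u huH, hχu, Bool.xor_false, hcoe x u huH]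
  have hTc : ∀ (ε : G ⧸ H → Bool) (x : G), x ∈ (Finset.univ.filter fun y : G => up y = ε (y : G ⧸ H)) ↔
      c * x ∉ (Finset.univ.filter fun y : G => up y = ε (y : G ⧸ H)) := by
    intro ε x
    rw [hT, hT, hcen x, hupmul x c hcH, hχc, Bool.xor_true, hcoe x c hcH]
    cases up x <;> cases ε (x : G ⧸ H) <;> simp
  -- (c) a left stabiliser `v` forces the twisted system
  have hstab : ∀ (ε : G ⧸ H → Bool) (v : G),
      (∀ x, x ∈ (Finset.univ.filter fun y : G => up y = ε (y : G ⧸ H)) ↔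
        v * x ∈ (Finset.univ.filter fun y : G => up y = ε (y : G ⧸ H))) →
      ∀ q : G ⧸ H, ε (v • q) = xor (ε q) (up (v * rep q)) := by
    intro ε v hv q
    have e1 : ((v * rep q : G) : G ⧸ H) = v • q := by rw [← smul_eq_mul, ← MulAction.Quotient.smul_coe, hrep]
    have h1 := hv (rep q)
    rw [hT, hT, huprep, hrep, e1] at h1
    have h2 := hv (rep q * c)
    rw [hT, hT, hupmul _ c hcH, huprep, hχc, hcoe _ c hcH, hrep, ← mul_assoc, hupmul _ c hcH, hχc,
      hcoe _ c hcH, e1] at h2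
    revert h1 h2
    cases ε q <;> cases ε (v • q) <;> cases up (v * rep q) <;> simp
  -- (d) fixed points with trivial twist lie in a fibre of `q ↦ rep q · u · (rep q)⁻¹`
  have hfix : ∀ (v : G), v ≠ 1 → ∀ q : G ⧸ H, v • q = q → up (v * rep q) = false → rep q * u * (rep q)⁻¹ = v := by
    intro v hv q hq hupv
    have e1 : ((v * rep q : G) : G ⧸ H) = v • q := by rw [← smul_eq_mul, ← MulAction.Quotient.smul_coe, hrep]
    have hw : (rep q)⁻¹ * (v * rep q) ∈ H := by
      have := hrepH (v * rep q); rwa [e1, hq] at this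
    have hup' : up (v * rep q) = χ ((rep q)⁻¹ * (v * rep q)) := by simp only [hup, e1, hq]
    rw [hup'] at hupv
    rcases (hH _).1 hw with h | h | h | h
    · exfalso; apply hv
      have := congrArg (rep q * ·) h
      simp only [mul_inv_cancel_left, mul_one] at this
      exact mul_right_cancel (this.trans (one_mul (rep q)).symm)
    · have := congrArg (fun z => rep q * z * (rep q)⁻¹) h
      simp only [mul_inv_cancel_left, mul_inv_cancel_right] at this
      exact this.symm
    · rw [h] at hupv; simp [hχ] at hupv
    · rw [h] at hupv; simp [hχ] at hupv
  -- (d') a conjugate of `cu` has a fixed point with NON-trivial twist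
  have hbad : ∀ (v g : G), g * u * g⁻¹ = c * v → ∃ q : G ⧸ H, v • q = q ∧ up (v * rep q) = true := by
    intro v g hg
    -- `v = c · g u g⁻¹`, so `v g = g (cu)`
    have h1 : v = c * (g * u * g⁻¹) := by rw [hg, ← mul_assoc, hcc, one_mul]
    have hvg : v * g = g * (c * u) := by
      rw [h1]
      calc c * (g * u * g⁻¹) * g = c * g * u := by group
        _ = g * c * u := by rw [hcen g]
        _ = g * (c * u) := mul_assoc _ _ _
    refine ⟨(g : G ⧸ H), ?_, ?_⟩
    · rw [MulAction.Quotient.smul_coe, smul_eq_mul, hvg]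
      exact hcoe g (c * u) hcuH
    · -- `rep ḡ = g w` with `w ∈ H`; `v (g w) = g (cu) w = (g w) (cu)` since `H` is abelian
      set w := g⁻¹ * rep (g : G ⧸ H) with hwdef
      have hw : w ∈ H := by
        have h3 : w = ((rep (g : G ⧸ H))⁻¹ * g)⁻¹ := by rw [hwdef, mul_inv_rev, inv_inv]
        rw [h3]
        exact H.inv_mem (hrepH g)
      have hrepg : rep (g : G ⧸ H) = g * w := by rw [hwdef, mul_inv_cancel_left]
      have hwcu : w * (c * u) = c * u * w := by
        rcases (hH w).1 hw with h | h | h | h <;> rw [h]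
        · rw [one_mul, mul_one]
        · rw [r1, r3]
        · rw [r2, r4]
      have e2 : v * rep (g : G ⧸ H) = rep (g : G ⧸ H) * (c * u) := by
        rw [hrepg, ← mul_assoc, hvg, mul_assoc, ← hwcu, ← mul_assoc]
      rw [e2, hupmul _ _ hcuH, huprep, hχcu]
      rfl
  -- (e) sizes: `|H| = 4`, `|G| = |P|·4`
  have hH4 : Nat.card H = 4 := by
    have hHeq : ∀ x : G, x ∈ H ↔ x ∈ ({1, u, c, c * u} : Finset G) := by
      intro x; rw [hH x]; simp only [Finset.mem_insert, Finset.mem_singleton]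
    have h4 : ({1, u, c, c * u} : Finset G).card = 4 := by
      rw [Finset.card_insert_of_notMem (by simp [hu1.symm, hc1.symm, hcu1.symm]),
        Finset.card_insert_of_notMem (by simp [huc, hcuu.symm]),
        Finset.card_insert_of_notMem (by simp [hcuc.symm]), Finset.card_singleton]
    have h5 : Nat.card H = Nat.card {x : G // x ∈ ({1, u, c, c * u} : Finset G)} :=
      Nat.card_congr (Equiv.subtypeEquiv (Equiv.refl G) fun x => hHeq x)
    rw [h5, Nat.card_eq_fintype_card, Fintype.card_coe, h4]
  have hGP : Nat.card G = Nat.card (G ⧸ H) * Nat.card H := Subgroup.card_eq_card_quotient_mul_card_subgroup H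
  rw [Nat.card_eq_fintype_card, Nat.card_eq_fintype_card, hH4] at hGP
  set n := Fintype.card (G ⧸ H) with hndef
  have hGn : Fintype.card G / 4 = n := by rw [hGP]; omega
  rw [hGn] at hcount
  -- (f) the fibre of `q ↦ rep q u (rep q)⁻¹` over `v`: empty outside `u^G`, of size `≤ |C_G(u)|/4` inside
  set F' : G → ℕ := fun v => (Finset.univ.filter fun q : G ⧸ H => rep q * u * (rep q)⁻¹ = v).card with hF'
  have hF0 : ∀ v : G, (∀ g : G, g * u * g⁻¹ ≠ v) → F' v = 0 := by
    intro v hv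
    simp only [hF']
    rw [Finset.card_eq_zero]
    exact Finset.eq_empty_of_forall_notMem fun q hq => hv (rep q) (Finset.mem_filter.1 hq).2
  have hFC : ∀ v : G, F' v * 4 ≤ (Finset.univ.filter fun g : G => g * u = u * g).card := by
    intro v
    by_cases hne : (Finset.univ.filter fun q : G ⧸ H => rep q * u * (rep q)⁻¹ = v) = ∅
    · simp only [hF']; rw [hne, Finset.card_empty]; exact Nat.zero_le _
    obtain ⟨q₀, hq₀⟩ := Finset.nonempty_iff_ne_empty.2 hne
    have hv : rep q₀ * u * (rep q₀)⁻¹ = v := (Finset.mem_filter.1 hq₀).2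
    set g₀ := rep q₀ with hg₀
    -- injection `(q, w) ↦ g₀⁻¹ rep(q) w` from fibre × H into `C_G(u)`
    have hHF : ({1, u, c, c * u} : Finset G).card = 4 := by
      rw [Finset.card_insert_of_notMem (by simp [hu1.symm, hc1.symm, hcu1.symm]),
        Finset.card_insert_of_notMem (by simp [huc, hcuu.symm]),
        Finset.card_insert_of_notMem (by simp [hcuc.symm]), Finset.card_singleton]
    have hmemHF : ∀ w : G, w ∈ ({1, u, c, c * u} : Finset G) ↔ w ∈ H := by
      intro w; rw [hH w]; simp only [Finset.mem_insert, Finset.mem_singleton]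
    set S := (Finset.univ.filter fun q : G ⧸ H => rep q * u * (rep q)⁻¹ = v) ×ˢ ({1, u, c, c * u} : Finset G) with hS
    have hScard : S.card = F' v * 4 := by rw [hS, Finset.card_product, hHF]
    have hmap : ∀ p ∈ S, (fun p : (G ⧸ H) × G => g₀⁻¹ * (rep p.1 * p.2)) p ∈
        (Finset.univ.filter fun g : G => g * u = u * g) := by
      rintro ⟨q, w⟩ hp
      rw [hS, Finset.mem_product] at hp
      obtain ⟨hq, hw⟩ := hp
      have hq' : rep q * u * (rep q)⁻¹ = v := (Finset.mem_filter.1 hq).2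
      have hw' : w ∈ H := (hmemHF w).1 hw
      rw [Finset.mem_filter, and_iff_right (Finset.mem_univ _)]
      -- `rep q · u · rep q⁻¹ = g₀ u g₀⁻¹` ⟹ `g₀⁻¹ rep q` centralises `u`; and `w` centralises `u`
      have h1 : g₀⁻¹ * rep q * u = u * (g₀⁻¹ * rep q) := by
        have h2 : rep q * u * (rep q)⁻¹ = g₀ * u * g₀⁻¹ := hq'.trans hv.symm
        have h3 : rep q * u = g₀ * u * g₀⁻¹ * rep q := by rw [← h2, inv_mul_cancel_right]
        calc g₀⁻¹ * rep q * u = g₀⁻¹ * (rep q * u) := by rw [mul_assoc]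
          _ = g₀⁻¹ * (g₀ * u * g₀⁻¹ * rep q) := by rw [h3]
          _ = u * (g₀⁻¹ * rep q) := by group
      calc g₀⁻¹ * (rep q * w) * u = g₀⁻¹ * rep q * (w * u) := by group
        _ = g₀⁻¹ * rep q * (u * w) := by rw [hHcomm w hw']
        _ = (g₀⁻¹ * rep q * u) * w := by group
        _ = u * (g₀⁻¹ * rep q) * w := by rw [h1]
        _ = u * (g₀⁻¹ * (rep q * w)) := by group
    have hinj : Set.InjOn (fun p : (G ⧸ H) × G => g₀⁻¹ * (rep p.1 * p.2)) ↑S := by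
      rintro ⟨q₁, w₁⟩ hp₁ ⟨q₂, w₂⟩ hp₂ h
      simp only at h
      have h' : rep q₁ * w₁ = rep q₂ * w₂ := mul_left_cancel h
      rw [hS, Finset.coe_product, Set.mem_prod] at hp₁ hp₂
      have hw₁ : w₁ ∈ H := (hmemHF w₁).1 hp₁.2
      have hw₂ : w₂ ∈ H := (hmemHF w₂).1 hp₂.2
      have hq : q₁ = q₂ := by
        rw [← hrep q₁, ← hrep q₂, ← hcoe (rep q₁) w₁ hw₁, ← hcoe (rep q₂) w₂ hw₂, h']
      subst hq
      have hw : w₁ = w₂ := mul_left_cancel h'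
      rw [hw]
    rw [← hScard]
    exact Finset.card_le_card_of_injOn _ hmap hinj
  -- (g) the count over the involutions `v ≠ c`
  set V := (Finset.univ : Finset G).filter (fun v => v * v = 1 ∧ v ≠ 1 ∧ v ≠ c) with hVdef
  have hterm : ∀ v ∈ V, 2 ^ ((Fintype.card (G ⧸ H) + (Finset.univ.filter fun q : G ⧸ H =>
      (v • q) = q ∧ up (v * rep q) = false).card) / 2) ≤ 2 ^ ((n + F' v) / 2) := by
    intro v hv
    have hv1 : v ≠ 1 := (Finset.mem_filter.1 hv).2.2.1
    have hsub : (Finset.univ.filter fun q : G ⧸ H => (v • q) = q ∧ up (v * rep q) = false) ⊆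
        (Finset.univ.filter fun q : G ⧸ H => rep q * u * (rep q)⁻¹ = v) := by
      intro q hq
      rw [Finset.mem_filter] at hq ⊢
      exact ⟨hq.1, hfix v hv1 q hq.2.1 hq.2.2⟩
    have h1 := Finset.card_le_card hsub
    exact Nat.pow_le_pow_right two_pos (by rw [← hndef]; simp only [hF']; omega)
  -- the «good» part of `V`: no conjugate of `cu`
  set Vg := V.filter (fun v => ¬ ∃ q : G ⧸ H, v • q = q ∧ up (v * rep q) = true) with hVg
  have hVg_sub : Vg ⊆ V.filter (fun v => ∀ g : G, g * u * g⁻¹ ≠ c * v) := by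
    intro v hv
    rw [hVg, Finset.mem_filter] at hv
    rw [Finset.mem_filter]
    exact ⟨hv.1, fun g hg => hv.2 (hbad v g hg)⟩
  -- split by membership in `u^G`
  set A := (V.filter (fun v => ∀ g : G, g * u * g⁻¹ ≠ c * v)).filter (fun v => ∀ g : G, g * u * g⁻¹ ≠ v) with hA
  set B := (V.filter (fun v => ∀ g : G, g * u * g⁻¹ ≠ c * v)).filter (fun v => ¬ ∀ g : G, g * u * g⁻¹ ≠ v) with hB
  have hAcard : A.card ≤ (Finset.univ.filter fun v : G => v * v = 1 ∧ v ≠ 1 ∧ v ≠ c ∧ (∀ g : G, g * u * g⁻¹ ≠ v) ∧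
      (∀ g : G, g * u * g⁻¹ ≠ c * v)).card := by
    refine Finset.card_le_card fun v hv => ?_
    rw [hA, Finset.mem_filter, Finset.mem_filter, hVdef, Finset.mem_filter] at hv
    rw [Finset.mem_filter]
    exact ⟨hv.1.1.1, hv.1.1.2.1, hv.1.1.2.2.1, hv.1.1.2.2.2, hv.2, hv.1.2⟩
  have hSA : ∑ v ∈ A, 2 ^ ((n + F' v) / 2) ≤ (Finset.univ.filter fun v : G => v * v = 1 ∧ v ≠ 1 ∧ v ≠ c ∧
      (∀ g : G, g * u * g⁻¹ ≠ v) ∧ (∀ g : G, g * u * g⁻¹ ≠ c * v)).card * 2 ^ (n / 2) := by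
    calc ∑ v ∈ A, 2 ^ ((n + F' v) / 2) = ∑ v ∈ A, 2 ^ (n / 2) :=
          Finset.sum_congr rfl fun v hv => by
            rw [hF0 v (Finset.mem_filter.1 hv).2, Nat.add_zero]
      _ = A.card * 2 ^ (n / 2) := by rw [Finset.sum_const, smul_eq_mul]
      _ ≤ _ := Nat.mul_le_mul_right _ hAcard
  have hSB : ∑ v ∈ B, 2 ^ ((n + F' v) / 2) ≤
      (if ∃ g : G, g * u * g⁻¹ = c * u then 0 else
        (Finset.univ.filter fun v : G => ∃ g : G, g * u * g⁻¹ = v).card *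
          2 ^ ((n + (Finset.univ.filter fun g : G => g * u = u * g).card / 4) / 2)) := by
    split_ifs with hucu
    · -- `u ~ cu`: then every `v ∈ u^G` is conjugate to `cu`, so `B = ∅`
      have hBe : B = ∅ := by
        refine Finset.eq_empty_of_forall_notMem fun v hv => ?_
        rw [hB, Finset.mem_filter, Finset.mem_filter] at hv
        obtain ⟨⟨-, hvcu⟩, hvu⟩ := hv
        apply hvu
        intro g hg
        obtain ⟨g₁, hg₁⟩ := hucu
        -- `v = g u g⁻¹`, `cu = g₁ u g₁⁻¹` ⟹ `c v = (g g₁) u (g g₁)⁻¹`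
        apply hvcu (g * g₁)
        calc g * g₁ * u * (g * g₁)⁻¹ = g * (g₁ * u * g₁⁻¹) * g⁻¹ := by group
          _ = g * (c * u) * g⁻¹ := by rw [hg₁]
          _ = g * c * u * g⁻¹ := by group
          _ = c * g * u * g⁻¹ := by rw [hcen g]
          _ = c * (g * u * g⁻¹) := by group
          _ = c * v := by rw [hg]
      rw [hBe, Finset.sum_empty]
    · calc ∑ v ∈ B, 2 ^ ((n + F' v) / 2)
          ≤ ∑ v ∈ B, 2 ^ ((n + (Finset.univ.filter fun g : G => g * u = u * g).card / 4) / 2) :=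
            Finset.sum_le_sum fun v _ => Nat.pow_le_pow_right two_pos (by
              have := hFC v; omega)
        _ = B.card * 2 ^ ((n + (Finset.univ.filter fun g : G => g * u = u * g).card / 4) / 2) := by
            rw [Finset.sum_const, smul_eq_mul]
        _ ≤ _ := Nat.mul_le_mul_right _ (Finset.card_le_card fun v hv => by
            rw [hB, Finset.mem_filter] at hv
            rw [Finset.mem_filter, and_iff_right (Finset.mem_univ _)]
            by_contra h
            exact hv.2 fun g hg => h ⟨g, hg⟩)
  have hcount' : ∑ v ∈ Vg,
      2 ^ ((Fintype.card (G ⧸ H) + (Finset.univ.filter fun q : G ⧸ H =>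
        (v • q) = q ∧ up (v * rep q) = false).card) / 2) < 2 ^ Fintype.card (G ⧸ H) := by
    calc ∑ v ∈ Vg, 2 ^ ((Fintype.card (G ⧸ H) + (Finset.univ.filter fun q : G ⧸ H =>
          (v • q) = q ∧ up (v * rep q) = false).card) / 2)
        ≤ ∑ v ∈ V.filter (fun v => ∀ g : G, g * u * g⁻¹ ≠ c * v), 2 ^ ((Fintype.card (G ⧸ H) +
            (Finset.univ.filter fun q : G ⧸ H => (v • q) = q ∧ up (v * rep q) = false).card) / 2) :=
          Finset.sum_le_sum_of_subset_of_nonneg hVg_sub fun _ _ _ => Nat.zero_le _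
      _ ≤ ∑ v ∈ V.filter (fun v => ∀ g : G, g * u * g⁻¹ ≠ c * v), 2 ^ ((n + F' v) / 2) :=
          Finset.sum_le_sum fun v hv => hterm v (Finset.mem_filter.1 hv).1
      _ = ∑ v ∈ A, 2 ^ ((n + F' v) / 2) + ∑ v ∈ B, 2 ^ ((n + F' v) / 2) := by
          rw [hA, hB, Finset.sum_filter_add_sum_filter_not]
      _ ≤ _ := Nat.add_le_add hSA hSB
      _ < 2 ^ n := hcount
  -- (h) a section violating every involution's system
  obtain ⟨ε, hε⟩ := SectionCount.exists_forall_violated_bad V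
    (fun v (q : G ⧸ H) => v • q) (fun v _ => MulAction.injective v) (fun v q => up (v * rep q)) hcount'
  refine ⟨Finset.univ.filter fun y : G => up y = ε (y : G ⧸ H), hTc ε, fun v hv => ?_, hTu ε⟩
  by_contra hcon
  have hcon' : ∀ x, x ∈ (Finset.univ.filter fun y : G => up y = ε (y : G ⧸ H)) ↔
      v * x ∈ (Finset.univ.filter fun y : G => up y = ε (y : G ⧸ H)) := fun x => by
    by_contra h; exact hcon ⟨x, h⟩
  -- a power `v^m` of `v` is an involution (or `c`) and still stabilises
  obtain ⟨m, hm1, hmm⟩ := h2 v hv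
  have hconw : ∀ (j : ℕ) (x : G), x ∈ (Finset.univ.filter fun y : G => up y = ε (y : G ⧸ H)) ↔
      v ^ j * x ∈ (Finset.univ.filter fun y : G => up y = ε (y : G ⧸ H)) := by
    intro j
    induction j with
    | zero => intro x; rw [pow_zero, one_mul]
    | succ j ih => intro x; rw [pow_succ, mul_assoc]; exact (hcon' x).trans (ih (v * x))
  by_cases hwc : v ^ m = c
  · -- `c` never stabilises a CM set
    have h1 := hconw m 1
    have h3 := hTc ε 1
    rw [hwc, mul_one] at h1
    rw [mul_one] at h3
    by_cases h : (1 : G) ∈ (Finset.univ.filter fun y : G => up y = ε (y : G ⧸ H))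
    · exact (h3.1 h) (h1.1 h)
    · exact h (h1.2 (not_not.1 fun h4 => h (h3.2 h4)))
  · have hwV : v ^ m ∈ V := by
      rw [hVdef, Finset.mem_filter]
      exact ⟨Finset.mem_univ _, hmm, hm1, hwc⟩
    obtain ⟨q, hq⟩ := hε (v ^ m) hwV
    exact hq (hstab ε (v ^ m) (hconw m) q)

end Summit.HodgeConjecture.CorCM.GaloisModels.SkewSection
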